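import Summits.CriticalPhenomena.CardyFormulaZ2.Theorems.CardyBoundaryCoulombGasHalfPlaneMarkDensityLawDensityWindow

/-!
# `HalfPlaneMarkDensityLaw` (crux stmt-CriticalPhenomena-5661), line `Sketch`:
# the SUBSEQUENTIAL difference-quotient lemma (pure real analysis; lead c4-0)

The difference-quotient lemma of the line (`stub_densityFromIncrements`, stub D) assumes that the
limit `G` of the lattice CDF is differentiable at `x` and concludes that the rescaled point mass
`n · g n ⌊xn⌋` converges to `G'(x)`.  Here the differentiability hypothesis is REMOVED and becomes a
conclusion, and the CDF is only assumed to converge along a SUBSEQUENCE `θ`: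

if `g n : ℤ → ℝ` is Lipschitz at scale `n⁻²` on the lattice window `[⌊(x−δ₀)n⌋, ⌊(x+δ₀)n⌋]`
(`|g n k' − g n k| ≤ C (k'−k)/n²`), its window sums are the increments of `P n : ℝ → ℝ`
(`Σ_{⌊yn⌋ < k ≤ ⌊y'n⌋} g n k = P n y' − P n y`, exact telescoping), and `P (θ j) y → G y` for every
`y ∈ (x−δ₀, x+δ₀)` along some `θ → ∞`, THEN

* the rescaled point mass converges along the same subsequence: `θ j · g (θ j) ⌊x θ j⌋ → ρ`
  (`tendsto_pointMass`), with no further extraction;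
* `G` is differentiable at `x` with derivative `ρ` (`tendsto_pointMass_and_hasDerivAt`,
  `hasDerivAt_of_taylor_bounds`; closed registered form `stub_subseqDifferenceQuotient`), quantitatively
  `|G (x+t) − G x − ρ t| ≤ C t²` and `|G x − G (x−t) − ρ t| ≤ C t²` for `0 < t < δ₀`
  (`abs_rightIncrement_sub_le`, `abs_leftIncrement_sub_le`);
* limits at two points inherit the lattice Lipschitz bound (`abs_sub_le_of_pointMass`).

Proof: the window estimate of `…DensityWindow` gives
`|(P n (x+t) − P n x) − (M_n/n)·(n · g n ⌊xn⌋)| ≤ C (M_n/n)²` with `M_n/n → t`; so along `θ` the point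
masses are eventually within `2Ct + o(1)` of `(G(x+t) − G x)/t`, for EVERY `t ∈ (0,δ₀)` — a Cauchy
sequence; the two Taylor bounds follow by passing to the limit, and they are the derivative.
Everything is elementary (`ℝ` complete).
-/

noncomputable section

namespace Summit.CriticalPhenomena.CardyFormulaZ2.Cruxes.HalfPlaneMarkDensityLaw.SketchLine

open MeasureTheory Filter Set
open scoped Topology
open Summit.CriticalPhenomena.CardyFormulaZ2.Theorems.HalfPlaneMarkDensityLaw.Negative

namespace Density

/-! ### Along a subsequence on which the CDF converges: convergence of the point mass, derivative -/

section Subseq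

variable {g : ℕ → ℤ → ℝ} {P : ℕ → ℝ → ℝ} {G : ℝ → ℝ} {x δ₀ C : ℝ} {θ : ℕ → ℕ}

/-- Along `θ`, the right window ratio converges: `(P (x+t) − P x)/(M/n) → (G (x+t) − G x)/t`, and the
point mass is eventually within `2Ct + τ` of it. [folklore] -/
theorem eventually_abs_pointMass_sub_slope_lt (hC : 0 ≤ C) (hδ₀ : 0 ≤ δ₀)
    (hwin : ∀ n : ℕ, ∀ y y' : ℝ, x - δ₀ ≤ y → y ≤ y' → y' ≤ x + δ₀ →
      ∑ i ∈ Finset.range (⌊y' * n⌋ - ⌊y * n⌋).toNat, g n (⌊y * n⌋ + 1 + i) = P n y' - P n y)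
    (hlip : ∀ n : ℕ, 1 ≤ n → ∀ k k' : ℤ, ⌊(x - δ₀) * n⌋ ≤ k → k ≤ k' → k' ≤ ⌊(x + δ₀) * n⌋ →
      |g n k' - g n k| ≤ C * (k' - k) / (n : ℝ) ^ 2)
    (hθ : Tendsto θ atTop atTop)
    {t : ℝ} (ht : 0 < t) (htδ : t ≤ δ₀)
    (hPx : Tendsto (fun j ↦ P (θ j) x) atTop (𝓝 (G x)))
    (hPt : Tendsto (fun j ↦ P (θ j) (x + t)) atTop (𝓝 (G (x + t))))
    {τ : ℝ} (hτ : 0 < τ) :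
    ∀ᶠ j : ℕ in atTop, |(θ j : ℝ) * g (θ j) ⌊x * θ j⌋ - (G (x + t) - G x) / t| < 2 * C * t + τ := by
  have hMlim : Tendsto (fun j ↦ ((⌊(x + t) * (θ j : ℕ)⌋ - ⌊x * (θ j : ℕ)⌋).toNat : ℝ) / (θ j : ℕ)) atTop (𝓝 t) :=
    (tendsto_rwin_div (x := x) ht.le).comp hθ
  have hq : Tendsto (fun j ↦ (P (θ j) (x + t) - P (θ j) x) / (((⌊(x + t) * (θ j : ℕ)⌋ - ⌊x * (θ j : ℕ)⌋).toNat : ℝ) / (θ j : ℕ)))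
      atTop (𝓝 ((G (x + t) - G x) / t)) := (hPt.sub hPx).div hMlim ht.ne'
  have hq_ev : ∀ᶠ j : ℕ in atTop,
      |(P (θ j) (x + t) - P (θ j) x) / (((⌊(x + t) * (θ j : ℕ)⌋ - ⌊x * (θ j : ℕ)⌋).toNat : ℝ) / (θ j : ℕ)) - (G (x + t) - G x) / t|
        < τ := by
    have := (Metric.tendsto_nhds.1 hq) τ hτ
    simpa only [Real.dist_eq] using this
  have hMpos : ∀ᶠ j : ℕ in atTop, t / 2 < ((⌊(x + t) * (θ j : ℕ)⌋ - ⌊x * (θ j : ℕ)⌋).toNat : ℝ) / (θ j : ℕ) :=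
    hMlim.eventually (lt_mem_nhds (by linarith))
  have hMup : ∀ᶠ j : ℕ in atTop, ((⌊(x + t) * (θ j : ℕ)⌋ - ⌊x * (θ j : ℕ)⌋).toNat : ℝ) / (θ j : ℕ) < 2 * t :=
    hMlim.eventually (gt_mem_nhds (by linarith))
  have hn1 : ∀ᶠ j : ℕ in atTop, 1 ≤ θ j := hθ.eventually (eventually_ge_atTop 1)
  filter_upwards [hq_ev, hMpos, hMup, hn1] with j hqj hMp hMu hn
  have hest := abs_rightWindow_sub_le hC hδ₀ hwin hlip ht.le htδ hn
  set m : ℝ := ((⌊(x + t) * (θ j : ℕ)⌋ - ⌊x * (θ j : ℕ)⌋).toNat : ℝ) / (θ j : ℕ) with hm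
  set d : ℝ := ((θ j : ℕ) : ℝ) * g (θ j) ⌊x * (θ j : ℕ)⌋ with hd
  set Δ : ℝ := P (θ j) (x + t) - P (θ j) x with hΔ
  have hm0 : 0 < m := by linarith
  -- `|d − Δ/m| ≤ C m ≤ 2 C t`
  have h1 : |d - Δ / m| ≤ C * m := by
    have hkey : d - Δ / m = -(m⁻¹ * (Δ - m * d)) := by field_simp; ring
    rw [hkey, abs_neg, abs_mul, abs_inv, abs_of_pos hm0]
    calc m⁻¹ * |Δ - m * d| ≤ m⁻¹ * (C * m ^ 2) :=
          mul_le_mul_of_nonneg_left hest (inv_nonneg.2 hm0.le)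
      _ = C * m := by field_simp
  have h2 : C * m ≤ 2 * C * t := by nlinarith
  rw [abs_sub_lt_iff] at hqj ⊢
  rw [abs_le] at h1
  constructor <;> linarith [h1.1, h1.2, hqj.1, hqj.2]

/-- **The point mass converges along `θ`** (no further extraction): if the CDF converges along `θ` at
every point of `(x−δ₀, x+δ₀)`, the rescaled point masses `θ j · g (θ j) ⌊x θ j⌋` form a Cauchy, hence
convergent, sequence. [folklore] -/
theorem tendsto_pointMass (hC : 0 ≤ C) (hδ₀ : 0 < δ₀)
    (hwin : ∀ n : ℕ, ∀ y y' : ℝ, x - δ₀ ≤ y → y ≤ y' → y' ≤ x + δ₀ →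
      ∑ i ∈ Finset.range (⌊y' * n⌋ - ⌊y * n⌋).toNat, g n (⌊y * n⌋ + 1 + i) = P n y' - P n y)
    (hlip : ∀ n : ℕ, 1 ≤ n → ∀ k k' : ℤ, ⌊(x - δ₀) * n⌋ ≤ k → k ≤ k' → k' ≤ ⌊(x + δ₀) * n⌋ →
      |g n k' - g n k| ≤ C * (k' - k) / (n : ℝ) ^ 2)
    (hθ : Tendsto θ atTop atTop)
    (hP : ∀ y : ℝ, x - δ₀ < y → y < x + δ₀ → Tendsto (fun j ↦ P (θ j) y) atTop (𝓝 (G y))) :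
    ∃ ρ : ℝ, Tendsto (fun j ↦ (θ j : ℝ) * g (θ j) ⌊x * θ j⌋) atTop (𝓝 ρ) := by
  have hPx : Tendsto (fun j ↦ P (θ j) x) atTop (𝓝 (G x)) := hP x (by linarith) (by linarith)
  refine cauchySeq_tendsto_of_complete (Metric.cauchySeq_iff.2 fun ε hε ↦ ?_)
  -- choose `t` with `8 C t ≤ ε`, `t < δ₀`
  obtain ⟨t, ht0, htδ, htε⟩ : ∃ t : ℝ, 0 < t ∧ t < δ₀ ∧ 8 * C * t ≤ ε := by
    refine ⟨min (δ₀ / 2) (ε / (8 * C + 1)), lt_min (by linarith) (by positivity),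
      (min_le_left _ _).trans_lt (by linarith), ?_⟩
    have h := min_le_right (δ₀ / 2) (ε / (8 * C + 1))
    have h' : 8 * C * (ε / (8 * C + 1)) ≤ ε := by
      rw [mul_div_assoc']
      rw [div_le_iff₀ (by positivity)]
      nlinarith
    nlinarith [lt_min (by linarith : (0:ℝ) < δ₀ / 2) (by positivity : (0:ℝ) < ε / (8 * C + 1))]
  have hPt : Tendsto (fun j ↦ P (θ j) (x + t)) atTop (𝓝 (G (x + t))) :=
    hP (x + t) (by linarith) (by linarith)
  have hev := eventually_abs_pointMass_sub_slope_lt hC hδ₀.le hwin hlip hθ ht0 htδ.le hPx hPt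
    (τ := ε / 4) (by positivity)
  obtain ⟨N, hN⟩ := eventually_atTop.1 hev
  refine ⟨N, fun m hm n hn ↦ ?_⟩
  have h1 := hN m hm
  have h2 := hN n hn
  rw [Real.dist_eq]
  rw [abs_sub_lt_iff] at h1 h2 ⊢
  constructor <;> linarith [h1.1, h1.2, h2.1, h2.2]

/-- **Right Taylor bound.** If the point masses converge to `ρ` along `θ`, then for `0 < t ≤ δ₀`
(with the CDF converging at `x` and `x+t`): `|G (x+t) − G x − ρ t| ≤ C t²`. [folklore] -/
theorem abs_rightIncrement_sub_le (hC : 0 ≤ C) (hδ₀ : 0 ≤ δ₀)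
    (hwin : ∀ n : ℕ, ∀ y y' : ℝ, x - δ₀ ≤ y → y ≤ y' → y' ≤ x + δ₀ →
      ∑ i ∈ Finset.range (⌊y' * n⌋ - ⌊y * n⌋).toNat, g n (⌊y * n⌋ + 1 + i) = P n y' - P n y)
    (hlip : ∀ n : ℕ, 1 ≤ n → ∀ k k' : ℤ, ⌊(x - δ₀) * n⌋ ≤ k → k ≤ k' → k' ≤ ⌊(x + δ₀) * n⌋ →
      |g n k' - g n k| ≤ C * (k' - k) / (n : ℝ) ^ 2)
    (hθ : Tendsto θ atTop atTop)
    {t : ℝ} (ht : 0 < t) (htδ : t ≤ δ₀)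
    (hPx : Tendsto (fun j ↦ P (θ j) x) atTop (𝓝 (G x)))
    (hPt : Tendsto (fun j ↦ P (θ j) (x + t)) atTop (𝓝 (G (x + t))))
    {ρ : ℝ} (hρ : Tendsto (fun j ↦ (θ j : ℝ) * g (θ j) ⌊x * θ j⌋) atTop (𝓝 ρ)) :
    |G (x + t) - G x - ρ * t| ≤ C * t ^ 2 := by
  have hMlim : Tendsto (fun j ↦ ((⌊(x + t) * (θ j : ℕ)⌋ - ⌊x * (θ j : ℕ)⌋).toNat : ℝ) / (θ j : ℕ)) atTop (𝓝 t) :=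
    (tendsto_rwin_div (x := x) ht.le).comp hθ
  have hL : Tendsto (fun j ↦ |(P (θ j) (x + t) - P (θ j) x)
      - ((⌊(x + t) * (θ j : ℕ)⌋ - ⌊x * (θ j : ℕ)⌋).toNat : ℝ) / (θ j : ℕ) * ((θ j : ℝ) * g (θ j) ⌊x * θ j⌋)|) atTop
      (𝓝 |G (x + t) - G x - t * ρ|) :=
    ((hPt.sub hPx).sub (hMlim.mul hρ)).abs
  have hR : Tendsto (fun j ↦ C * (((⌊(x + t) * (θ j : ℕ)⌋ - ⌊x * (θ j : ℕ)⌋).toNat : ℝ) / (θ j : ℕ)) ^ 2) atTop (𝓝 (C * t ^ 2)) :=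
    (hMlim.pow 2).const_mul C
  have hn1 : ∀ᶠ j : ℕ in atTop, 1 ≤ θ j := hθ.eventually (eventually_ge_atTop 1)
  have hle : ∀ᶠ j : ℕ in atTop, |(P (θ j) (x + t) - P (θ j) x)
      - ((⌊(x + t) * (θ j : ℕ)⌋ - ⌊x * (θ j : ℕ)⌋).toNat : ℝ) / (θ j : ℕ) * ((θ j : ℝ) * g (θ j) ⌊x * θ j⌋)|
        ≤ C * (((⌊(x + t) * (θ j : ℕ)⌋ - ⌊x * (θ j : ℕ)⌋).toNat : ℝ) / (θ j : ℕ)) ^ 2 := by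
    filter_upwards [hn1] with j hj using abs_rightWindow_sub_le hC hδ₀ hwin hlip ht.le htδ hj
  have := le_of_tendsto_of_tendsto hL hR hle
  rwa [mul_comm t ρ] at this

/-- **Left Taylor bound.** Symmetrically, for `0 < t ≤ δ₀` (CDF converging at `x` and `x−t`):
`|G x − G (x−t) − ρ t| ≤ C t²`. [folklore] -/
theorem abs_leftIncrement_sub_le (hC : 0 ≤ C) (hδ₀ : 0 ≤ δ₀)
    (hwin : ∀ n : ℕ, ∀ y y' : ℝ, x - δ₀ ≤ y → y ≤ y' → y' ≤ x + δ₀ →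
      ∑ i ∈ Finset.range (⌊y' * n⌋ - ⌊y * n⌋).toNat, g n (⌊y * n⌋ + 1 + i) = P n y' - P n y)
    (hlip : ∀ n : ℕ, 1 ≤ n → ∀ k k' : ℤ, ⌊(x - δ₀) * n⌋ ≤ k → k ≤ k' → k' ≤ ⌊(x + δ₀) * n⌋ →
      |g n k' - g n k| ≤ C * (k' - k) / (n : ℝ) ^ 2)
    (hθ : Tendsto θ atTop atTop)
    {t : ℝ} (ht : 0 < t) (htδ : t ≤ δ₀)
    (hPx : Tendsto (fun j ↦ P (θ j) x) atTop (𝓝 (G x)))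
    (hPt : Tendsto (fun j ↦ P (θ j) (x - t)) atTop (𝓝 (G (x - t))))
    {ρ : ℝ} (hρ : Tendsto (fun j ↦ (θ j : ℝ) * g (θ j) ⌊x * θ j⌋) atTop (𝓝 ρ)) :
    |G x - G (x - t) - ρ * t| ≤ C * t ^ 2 := by
  have hMlim : Tendsto (fun j ↦ ((⌊x * (θ j : ℕ)⌋ - ⌊(x - t) * (θ j : ℕ)⌋).toNat : ℝ) / (θ j : ℕ)) atTop (𝓝 t) :=
    (tendsto_lwin_div (x := x) ht.le).comp hθ
  have hL : Tendsto (fun j ↦ |(P (θ j) x - P (θ j) (x - t))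
      - ((⌊x * (θ j : ℕ)⌋ - ⌊(x - t) * (θ j : ℕ)⌋).toNat : ℝ) / (θ j : ℕ) * ((θ j : ℝ) * g (θ j) ⌊x * θ j⌋)|) atTop
      (𝓝 |G x - G (x - t) - t * ρ|) :=
    ((hPx.sub hPt).sub (hMlim.mul hρ)).abs
  have hR : Tendsto (fun j ↦ C * (((⌊x * (θ j : ℕ)⌋ - ⌊(x - t) * (θ j : ℕ)⌋).toNat : ℝ) / (θ j : ℕ)) ^ 2) atTop (𝓝 (C * t ^ 2)) :=
    (hMlim.pow 2).const_mul C
  have hn1 : ∀ᶠ j : ℕ in atTop, 1 ≤ θ j := hθ.eventually (eventually_ge_atTop 1)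
  have hle : ∀ᶠ j : ℕ in atTop, |(P (θ j) x - P (θ j) (x - t))
      - ((⌊x * (θ j : ℕ)⌋ - ⌊(x - t) * (θ j : ℕ)⌋).toNat : ℝ) / (θ j : ℕ) * ((θ j : ℝ) * g (θ j) ⌊x * θ j⌋)|
        ≤ C * (((⌊x * (θ j : ℕ)⌋ - ⌊(x - t) * (θ j : ℕ)⌋).toNat : ℝ) / (θ j : ℕ)) ^ 2 := by
    filter_upwards [hn1] with j hj using abs_leftWindow_sub_le hC hδ₀ hwin hlip ht.le htδ hj
  have := le_of_tendsto_of_tendsto hL hR hle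
  rwa [mul_comm t ρ] at this

/-- **Two one-sided Taylor bounds of order two are a derivative.** If
`|G (x+t) − G x − ρ t| ≤ C t²` and `|G x − G (x−t) − ρ t| ≤ C t²` for `0 < t < δ₀`, then
`HasDerivAt G ρ x`. [folklore] -/
theorem hasDerivAt_of_taylor_bounds {G : ℝ → ℝ} {x ρ C δ₀ : ℝ} (hδ₀ : 0 < δ₀)
    (hright : ∀ t : ℝ, 0 < t → t < δ₀ → |G (x + t) - G x - ρ * t| ≤ C * t ^ 2)
    (hleft : ∀ t : ℝ, 0 < t → t < δ₀ → |G x - G (x - t) - ρ * t| ≤ C * t ^ 2) :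
    HasDerivAt G ρ x := by
  rw [hasDerivAt_iff_tendsto]
  have hbound : ∀ᶠ x' : ℝ in 𝓝 x,
      ‖x' - x‖⁻¹ * ‖G x' - G x - (x' - x) • ρ‖ ≤ |C| * |x' - x| := by
    have hI : Ioo (x - δ₀) (x + δ₀) ∈ 𝓝 x := Ioo_mem_nhds (by linarith) (by linarith)
    filter_upwards [hI] with x' hx'
    rcases lt_trichotomy x' x with hlt | heq | hgt
    · have ht : 0 < x - x' := by linarith
      have h := hleft (x - x') ht (by linarith [hx'.1])
      rw [show x - (x - x') = x' by ring] at h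
      rw [smul_eq_mul, Real.norm_eq_abs, Real.norm_eq_abs,
        show G x' - G x - (x' - x) * ρ = -(G x - G x' - ρ * (x - x')) by ring, abs_neg,
        abs_of_neg (by linarith : x' - x < 0)]
      have hC' : C * (x - x') ^ 2 ≤ |C| * (x - x') ^ 2 :=
        mul_le_mul_of_nonneg_right (le_abs_self C) (by positivity)
      rw [show -(x' - x) = x - x' by ring, inv_mul_le_iff₀ ht]
      nlinarith
    · subst heq; simp
    · have ht : 0 < x' - x := by linarith
      have h := hright (x' - x) ht (by linarith [hx'.2])
      rw [show x + (x' - x) = x' by ring] at h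
      rw [smul_eq_mul, Real.norm_eq_abs, Real.norm_eq_abs, abs_of_pos ht,
        show (x' - x) * ρ = ρ * (x' - x) by ring, inv_mul_le_iff₀ ht]
      have hC' : C * (x' - x) ^ 2 ≤ |C| * (x' - x) ^ 2 :=
        mul_le_mul_of_nonneg_right (le_abs_self C) (by positivity)
      nlinarith
  have hlow : ∀ᶠ x' : ℝ in 𝓝 x, 0 ≤ ‖x' - x‖⁻¹ * ‖G x' - G x - (x' - x) • ρ‖ :=
    Eventually.of_forall fun x' ↦ by positivity
  have hlim : Tendsto (fun x' : ℝ ↦ |C| * |x' - x|) (𝓝 x) (𝓝 0) := by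
    have : Tendsto (fun x' : ℝ ↦ |C| * |x' - x|) (𝓝 x) (𝓝 (|C| * |x - x|)) :=
      ((continuous_id.sub continuous_const).abs.const_mul _).tendsto x
    simpa using this
  exact tendsto_of_tendsto_of_tendsto_of_le_of_le' tendsto_const_nhds hlim hlow hbound

/-- **The subsequential difference-quotient lemma.** Under the `n⁻²`-Lipschitz bound and exact
telescoping on the window `[x−δ₀, x+δ₀]`, if the CDF `P (θ j)` converges pointwise on `(x−δ₀, x+δ₀)`
to `G` along some `θ → ∞`, then the point mass `θ j · g (θ j) ⌊x θ j⌋` converges along `θ` to a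
number `ρ` which IS the derivative of `G` at `x`, with second-order one-sided Taylor bounds.
No differentiability is assumed. [folklore] -/
theorem tendsto_pointMass_and_hasDerivAt (hC : 0 ≤ C) (hδ₀ : 0 < δ₀)
    (hwin : ∀ n : ℕ, ∀ y y' : ℝ, x - δ₀ ≤ y → y ≤ y' → y' ≤ x + δ₀ →
      ∑ i ∈ Finset.range (⌊y' * n⌋ - ⌊y * n⌋).toNat, g n (⌊y * n⌋ + 1 + i) = P n y' - P n y)
    (hlip : ∀ n : ℕ, 1 ≤ n → ∀ k k' : ℤ, ⌊(x - δ₀) * n⌋ ≤ k → k ≤ k' → k' ≤ ⌊(x + δ₀) * n⌋ →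
      |g n k' - g n k| ≤ C * (k' - k) / (n : ℝ) ^ 2)
    (hθ : Tendsto θ atTop atTop)
    (hP : ∀ y : ℝ, x - δ₀ < y → y < x + δ₀ → Tendsto (fun j ↦ P (θ j) y) atTop (𝓝 (G y))) :
    ∃ ρ : ℝ, Tendsto (fun j ↦ (θ j : ℝ) * g (θ j) ⌊x * θ j⌋) atTop (𝓝 ρ) ∧ HasDerivAt G ρ x ∧
      (∀ t : ℝ, 0 < t → t < δ₀ → |G (x + t) - G x - ρ * t| ≤ C * t ^ 2) ∧
      (∀ t : ℝ, 0 < t → t < δ₀ → |G x - G (x - t) - ρ * t| ≤ C * t ^ 2) := by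
  obtain ⟨ρ, hρ⟩ := tendsto_pointMass hC hδ₀ hwin hlip hθ hP
  have hPx : Tendsto (fun j ↦ P (θ j) x) atTop (𝓝 (G x)) := hP x (by linarith) (by linarith)
  have hright : ∀ t : ℝ, 0 < t → t < δ₀ → |G (x + t) - G x - ρ * t| ≤ C * t ^ 2 :=
    fun t ht htδ ↦ abs_rightIncrement_sub_le hC hδ₀.le hwin hlip hθ ht htδ.le hPx
      (hP (x + t) (by linarith) (by linarith)) hρ
  have hleft : ∀ t : ℝ, 0 < t → t < δ₀ → |G x - G (x - t) - ρ * t| ≤ C * t ^ 2 :=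
    fun t ht htδ ↦ abs_leftIncrement_sub_le hC hδ₀.le hwin hlip hθ ht htδ.le hPx
      (hP (x - t) (by linarith) (by linarith)) hρ
  exact ⟨ρ, hρ, hasDerivAt_of_taylor_bounds hδ₀ hright hleft, hright, hleft⟩

/-- **Registered extra stub of line `Sketch` (lead c4-0): the subsequential difference-quotient
lemma**, closed form of `tendsto_pointMass_and_hasDerivAt`. [folklore] -/
theorem stub_subseqDifferenceQuotient :
    ∀ (g : ℕ → ℤ → ℝ) (P : ℕ → ℝ → ℝ) (G : ℝ → ℝ) (x δ₀ C : ℝ) (θ : ℕ → ℕ), 0 ≤ C → 0 < δ₀ →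
      (∀ n : ℕ, ∀ y y' : ℝ, x - δ₀ ≤ y → y ≤ y' → y' ≤ x + δ₀ →
        ∑ i ∈ Finset.range (⌊y' * n⌋ - ⌊y * n⌋).toNat, g n (⌊y * n⌋ + 1 + i) = P n y' - P n y) →
      (∀ n : ℕ, 1 ≤ n → ∀ k k' : ℤ, ⌊(x - δ₀) * n⌋ ≤ k → k ≤ k' → k' ≤ ⌊(x + δ₀) * n⌋ →
        |g n k' - g n k| ≤ C * (k' - k) / (n : ℝ) ^ 2) →
      Tendsto θ atTop atTop →
      (∀ y : ℝ, x - δ₀ < y → y < x + δ₀ → Tendsto (fun j ↦ P (θ j) y) atTop (𝓝 (G y))) →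
      ∃ ρ : ℝ, Tendsto (fun j ↦ (θ j : ℝ) * g (θ j) ⌊x * θ j⌋) atTop (𝓝 ρ) ∧ HasDerivAt G ρ x ∧
        (∀ t : ℝ, 0 < t → t < δ₀ → |G (x + t) - G x - ρ * t| ≤ C * t ^ 2) ∧
        (∀ t : ℝ, 0 < t → t < δ₀ → |G x - G (x - t) - ρ * t| ≤ C * t ^ 2) :=
  fun _ _ _ _ _ _ _ hC hδ₀ hwin hlip hθ hP ↦ tendsto_pointMass_and_hasDerivAt hC hδ₀ hwin hlip hθ hP

end Subseq

/-! ### Limits at two points inherit the lattice Lipschitz bound -/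

/-- **Lipschitz limits.** If the point masses at `x` and `x'` converge along `θ → ∞` to `ρ` and `ρ'`,
and the lattice densities satisfy `|g n ⌊x'n⌋ − g n ⌊xn⌋| ≤ C |⌊x'n⌋ − ⌊xn⌋| / n²` eventually, then
`|ρ' − ρ| ≤ C |x' − x|`. [folklore] -/
theorem abs_sub_le_of_pointMass {g : ℕ → ℤ → ℝ} {x x' C ρ ρ' : ℝ} {θ : ℕ → ℕ}
    (hθ : Tendsto θ atTop atTop)
    (hlip : ∀ᶠ n : ℕ in atTop,
      |g n ⌊x' * n⌋ - g n ⌊x * n⌋| ≤ C * |((⌊x' * n⌋ - ⌊x * n⌋ : ℤ) : ℝ)| / (n : ℝ) ^ 2)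
    (hρ : Tendsto (fun j ↦ (θ j : ℝ) * g (θ j) ⌊x * θ j⌋) atTop (𝓝 ρ))
    (hρ' : Tendsto (fun j ↦ (θ j : ℝ) * g (θ j) ⌊x' * θ j⌋) atTop (𝓝 ρ')) :
    |ρ' - ρ| ≤ C * |x' - x| := by
  have hL : Tendsto (fun j ↦ |(θ j : ℝ) * g (θ j) ⌊x' * θ j⌋ - (θ j : ℝ) * g (θ j) ⌊x * θ j⌋|) atTop
      (𝓝 |ρ' - ρ|) := (hρ'.sub hρ).abs
  have hR : Tendsto (fun j ↦ C * |((⌊x' * (θ j : ℕ)⌋ - ⌊x * (θ j : ℕ)⌋ : ℤ) : ℝ) / (θ j : ℕ)|) atTop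
      (𝓝 (C * |x' - x|)) := (((tendsto_floor_sub_floor_div x x').comp hθ).abs).const_mul C
  have hn1 : ∀ᶠ j : ℕ in atTop, 1 ≤ θ j := hθ.eventually (eventually_ge_atTop 1)
  refine le_of_tendsto_of_tendsto hL hR ?_
  filter_upwards [hθ.eventually hlip, hn1] with j hj hn
  have hn' : (0 : ℝ) < (θ j : ℕ) := by exact_mod_cast hn
  rw [← mul_sub, abs_mul, abs_of_pos hn']
  calc ((θ j : ℕ) : ℝ) * |g (θ j) ⌊x' * (θ j : ℕ)⌋ - g (θ j) ⌊x * (θ j : ℕ)⌋|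
      ≤ ((θ j : ℕ) : ℝ) * (C * |((⌊x' * (θ j : ℕ)⌋ - ⌊x * (θ j : ℕ)⌋ : ℤ) : ℝ)| / ((θ j : ℕ) : ℝ) ^ 2) :=
        mul_le_mul_of_nonneg_left hj hn'.le
    _ = C * |((⌊x' * (θ j : ℕ)⌋ - ⌊x * (θ j : ℕ)⌋ : ℤ) : ℝ) / (θ j : ℕ)| := by
        rw [abs_div, abs_of_pos hn']
        field_simp

end Density

end Summit.CriticalPhenomena.CardyFormulaZ2.Cruxes.HalfPlaneMarkDensityLaw.SketchLine
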